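/- Fleet seat `ym-wcr-19608-p2` (g2), route `WeakCouplingRates`, crux `BulkDominatesColdBoxW` (stmt-QuantumFields-19609), stub `stub_kernelMeanExpansion`:
the A-mean core INSTANTIATED with the ϑ-datum trunk (T3/T4/R3-datum/R5-datum) — the deterministic bound at a fixed `β`. -/
import Summits.QuantumFields.YangMills.Theorems.WeakCouplingRatesColdBoxRepresentationDatum
import Summits.QuantumFields.YangMills.Theorems.WeakCouplingRatesBulkDominatesColdBoxWSmallFieldGoodTD
import Summits.QuantumFields.YangMills.Theorems.WeakCouplingRatesBulkDominatesColdBoxWKernelMeanCore2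
import Summits.QuantumFields.YangMills.Theorems.WeakCouplingRatesBulkDominatesColdBoxWUnitsShift

/-!
# Crux `BulkDominatesColdBoxW`, stub `stub_kernelMeanExpansion`: the mean core instantiated with the trunk (deterministic form)

`abs_kernelMean_sub_gaussian_le_core₂` (`…KernelMeanCore2`, lead `ym-wcr-19609-p1` g2) bounds the deviation of the kernel mean `β·E_{γ(·|W)} c_q` from its
Gaussian value `(3/2)C_D(q,q) + ½Σ_c F_c²` in terms of abstract hypotheses: a representation identity `hRep`, a tilt bound, the on-`S` bound and the
linearisation error of the observable, and the two bad masses.  This file DISCHARGES the abstract hypotheses with the ϑ-datum trunk of this seat —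
T3 `integral_cond_boxKernel_eq_integral_tilted_datum`, T4 `abs_tiltWD_le_of_mem_goodTD`, R3-datum `abs_beta_mul_plaqCostAt_sub_qObsD_le_of_mem_goodTD`,
`beta_mul_plaqCostAt_mem_Icc_of_mem_goodTD` — together with the goodTD sandwich `gauss3_real_compl_goodTD_le` (lead g2) and the units identity
`qObsD_eq_half_sum_sq`: for an exterior datum `W = P(1, ϑ)` off the cold box (`Σ_c ϑ_{c,e}² ≤ r²`, `ϑ = 0` on the forest) whose scaled background circulations
are `≤ R'`, and numeric windows on the link bound `m`, the Gaussian radius `R`, and the YM bad mass `pY`,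

  `|β·E_{γ(·|W)} c_q − ((3/2)·C_D(q,q) + ½Σ_c (√(2β)F̄_c(q))²)| ≤ 8β·pY + β^{2ε}(e^{2w} − 1) + 362βm³ + 2(1 + 6Σ_c((√(2β)F̄_c(q))⁴ + 3C_D(q,q)²))·√p`

(`abs_kernelMean_sub_le_of_trunk`), `w = #(touching)·362βm³ + 2·#(free links)·m²`, `p = 720(2H+1)⁴e^{−R²/2}`, for every plaquette `q = (x,i,j)` touching the
box.  The exponent bookkeeping (`β → ∞`) and the registered stub are the next file.  No sorry; no new definition; standard axioms.  NOT a claim about the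
mass gap.
-/

set_option autoImplicit false

noncomputable section

open MeasureTheory ProbabilityTheory Finset
open Literature.Probability.LatticeModels (Site)
open Literature.MathematicalPhysics.QuantumLattice
open Literature.MathematicalPhysics.QuantumFieldTheory
open Literature.MathematicalPhysics.QuantumFieldTheory.LatticeMaxwell
open Literature.MathematicalPhysics.QuantumFieldTheory.AxialGauge

namespace Summit.QuantumFields.YangMills.Theorems.WeakCouplingRates

variable {H : ℕ}

/-- A probability measure gives nonzero mass to an event whose complement has mass `< 1`. -/
theorem boxKernel_ne_zero_of_real_compl_lt_one {β : ℝ} {W : LGConfig 4 (Matrix.specialUnitaryGroup (Fin 2) ℂ)}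
    {G : Set (LGConfig 4 (Matrix.specialUnitaryGroup (Fin 2) ℂ))} (hG : MeasurableSet G) {pY : ℝ}
    (hbad : (boxKernel β H W).real Gᶜ ≤ pY) (hpY : pY < 1) : boxKernel β H W G ≠ 0 := by
  haveI := isProbabilityMeasure_boxKernel β H W
  intro h0
  have h1 : (boxKernel β H W).real G = 0 := by rw [measureReal_def, h0, ENNReal.toReal_zero]
  have h2 : (boxKernel β H W).real G + (boxKernel β H W).real Gᶜ = 1 := by
    rw [measureReal_add_measureReal_compl hG, probReal_univ]
  linarith

/-- `gauss3(goodTD) ≠ 0` once the Gaussian bad mass bound is `< 1`. -/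
theorem gauss3_ne_zero_of_real_compl_lt_one {β ε : ℝ} {ϑ : Fin 3 → Literature.MathematicalPhysics.QuantumLattice.ZdEdge 4 → ℝ} {p : ℝ}
    (hp : (gauss3 H).real (goodTD H β ε ϑ)ᶜ ≤ p) (hp1 : p < 1) : gauss3 H (goodTD H β ε ϑ) ≠ 0 := by
  intro h0
  have h1 : (gauss3 H).real (goodTD H β ε ϑ) = 0 := by rw [measureReal_def, h0, ENNReal.toReal_zero]
  have h2 : (gauss3 H).real (goodTD H β ε ϑ) + (gauss3 H).real (goodTD H β ε ϑ)ᶜ = 1 := by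
    rw [measureReal_add_measureReal_compl (measurableSet_goodTD β ε ϑ), probReal_univ]
  linarith

/-- **The A-mean core instantiated with the ϑ-datum trunk (deterministic form).**  See the module docstring. -/
theorem abs_kernelMean_sub_le_of_trunk {β ε r R R' m pY : ℝ} (hβ : 0 < β) (hH : 1 ≤ H) (hr : 0 ≤ r) (hR : 0 ≤ R) (hR' : 0 ≤ R')
    {W : LGConfig 4 (Matrix.specialUnitaryGroup (Fin 2) ℂ)} {ϑ : Fin 3 → Literature.MathematicalPhysics.QuantumLattice.ZdEdge 4 → ℝ}
    (hW : ∀ e, e ∉ boxEdges 4 (2 * H + 1) → W e = gnomonicChart (fun c => ϑ c e))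
    (hϑ : ∀ e, e ∉ boxEdges 4 (2 * H + 1) → ∑ c, ϑ c e ^ 2 ≤ r ^ 2)
    (hforest : ∀ x : Site 4, (∀ k : Fin 4, 1 ≤ x k ∧ x k + 1 ≤ 2 * (H : ℤ)) → ∀ c, ϑ c (x, 0) = 0)
    (hF : ∀ (c : Fin 3) (p : ZdPlaquette 4), |sCirc (glue (pin := fun e => e ∉ dirFreeEdges H) dirCorner (2 * H + 3) (sdat β ϑ c)
        (mean (fun e => e ∉ dirFreeEdges H) dirCorner (2 * H + 3) (sdat β ϑ c))) (p.1, p.2.1.1, p.2.1.2)| ≤ R')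
    (hbad : (boxKernel β H W).real (coldGoodSet β ε H)ᶜ ≤ pY) (hpY1 : pY < 1)
    (hm : Real.sqrt 2 * ((12 * (H : ℝ) ^ 2 + 2 * H + 1) * (Real.sqrt (β ^ (2 * ε - 1)) + 8 * r)) ≤ m) (hm4 : m ≤ 1 / 4)
    (hmE : r ^ 2 + 3 * ((12 * (H : ℝ) ^ 2 + 2 * H + 1) * ((R + R') + 4 * (Real.sqrt (2 * β) * r))) ^ 2 / (2 * β) ≤ m ^ 2)
    (hwinE : 3 * (R + R') ^ 2 / (2 * β) + 362 * m ^ 3 < β ^ (2 * ε - 1))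
    (hp2 : 720 * (2 * (H : ℝ) + 1) ^ 4 * Real.exp (-R ^ 2 / 2) ≤ 1 / 2)
    {x : Site 4} {i j : Fin 4} (hij : i < j) (hx : ((x, ⟨(i, j), hij⟩) : ZdPlaquette 4) ∈ plaquettesTouching (boxEdges 4 (2 * H + 1))) :
    |β * (∫ U, plaqCostAt (fundamentalRep (Fin 2)) x i j U ∂(boxKernel β H W)) -
        (3 / 2 * boxDirProjKernel H (x, i, j) (x, i, j) +
          1 / 2 * ∑ c, (Real.sqrt (2 * β) * sCirc (glue (pin := fun e => e ∉ dirFreeEdges H) dirCorner (2 * H + 3) (ϑ c)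
            (mean (fun e => e ∉ dirFreeEdges H) dirCorner (2 * H + 3) (ϑ c))) (x, i, j)) ^ 2)| ≤
      2 * (4 * β) * pY +
        (β ^ (2 * ε) * (Real.exp (2 * ((#(plaquettesTouching (boxEdges 4 (2 * H + 1))) : ℝ) * (362 * β * m ^ 3) +
            2 * (Fintype.card (ColdFreeIdx H) : ℝ) * m ^ 2)) - 1) + 362 * β * m ^ 3 +
          2 * (1 + 6 * ∑ c, ((Real.sqrt (2 * β) * sCirc (glue (pin := fun e => e ∉ dirFreeEdges H) dirCorner (2 * H + 3) (ϑ c)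
            (mean (fun e => e ∉ dirFreeEdges H) dirCorner (2 * H + 3) (ϑ c))) (x, i, j)) ^ 4 + 3 * boxDirProjKernel H (x, i, j) (x, i, j) ^ 2)) *
            Real.sqrt (720 * (2 * (H : ℝ) + 1) ^ 4 * Real.exp (-R ^ 2 / 2))) := by
  -- abbreviations
  set G := coldGoodSet β ε H with hGdef
  set S := goodTD H β ε ϑ with hSdef
  set p : ℝ := 720 * (2 * (H : ℝ) + 1) ^ 4 * Real.exp (-R ^ 2 / 2) with hpdef
  set τ : ℝ := 362 * β * m ^ 3 with hτ
  set w : ℝ := (#(plaquettesTouching (boxEdges 4 (2 * H + 1))) : ℝ) * τ + 2 * (Fintype.card (ColdFreeIdx H) : ℝ) * m ^ 2 with hw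
  set F : Fin 3 → ℝ := fun c => Real.sqrt (2 * β) * sCirc (glue (pin := fun e => e ∉ dirFreeEdges H) dirCorner (2 * H + 3) (ϑ c)
    (mean (fun e => e ∉ dirFreeEdges H) dirCorner (2 * H + 3) (ϑ c))) (x, i, j) with hF'
  have hm0 : 0 ≤ m := le_trans (by positivity) hm
  have hτ0 : 0 ≤ τ := by positivity
  have hw0 : 0 ≤ w := by positivity
  -- the two good events are likely
  have hG : MeasurableSet G := measurableSet_coldGoodSet β ε H
  have hG0 : boxKernel β H W G ≠ 0 := boxKernel_ne_zero_of_real_compl_lt_one hG hbad hpY1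
  have hS : MeasurableSet S := measurableSet_goodTD β ε ϑ
  have hpS : (gauss3 H).real Sᶜ ≤ p := gauss3_real_compl_goodTD_le hβ hH hr hR hR' hϑ hforest hF hm0 hmE hm4 hwinE
  have hS0 : gauss3 H S ≠ 0 := gauss3_ne_zero_of_real_compl_lt_one hpS (by linarith)
  -- the window of T3 follows from `m ≤ 1/4`
  have hwinT3 : (12 * (H : ℝ) ^ 2 + 2 * H + 1) * (Real.sqrt (β ^ (2 * ε - 1)) + 8 * r) ≤ 1 := by
    have h2 : (1 : ℝ) ≤ Real.sqrt 2 := Real.one_le_sqrt.2 (by norm_num)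
    have h0 : 0 ≤ (12 * (H : ℝ) ^ 2 + 2 * H + 1) * (Real.sqrt (β ^ (2 * ε - 1)) + 8 * r) := by positivity
    nlinarith
  -- the observable
  have hXm : Measurable fun U : LGConfig 4 (Matrix.specialUnitaryGroup (Fin 2) ℂ) => β * plaqCostAt (fundamentalRep (Fin 2)) x i j U :=
    measurable_const.mul (measurable_plaqCostAt x i j)
  have hXinv : IsZdGaugeInvariant fun U : LGConfig 4 (Matrix.specialUnitaryGroup (Fin 2) ℂ) => β * plaqCostAt (fundamentalRep (Fin 2)) x i j U :=
    fun g U => by simp only [isZdGaugeInvariant_plaqCostAt (fundamentalRep (Fin 2)) x i j g U]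
  have hX0 : ∀ U : LGConfig 4 (Matrix.specialUnitaryGroup (Fin 2) ℂ), 0 ≤ β * plaqCostAt (fundamentalRep (Fin 2)) x i j U :=
    fun U => mul_nonneg hβ.le (plaqCostAt_nonneg _ _ _ _)
  have hfM : ∀ U : LGConfig 4 (Matrix.specialUnitaryGroup (Fin 2) ℂ), |β * plaqCostAt (fundamentalRep (Fin 2)) x i j U| ≤ 4 * β := by
    intro U
    rw [abs_mul, abs_of_pos hβ]
    calc β * |plaqCostAt (fundamentalRep (Fin 2)) x i j U| ≤ β * 4 := mul_le_mul_of_nonneg_left (abs_plaqCostAt_le x i j U) hβ.le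
      _ = 4 * β := by ring
  -- T3: the representation
  have hRep := integral_cond_boxKernel_eq_integral_tilted_datum (ε := ε) hβ hH hr hwinT3 hW hϑ hG0 hS0 hXm hXinv hX0
  -- T4: the tilt bound (indicator form)
  have hWt : ∀ t, |S.indicator (tiltWD H β ϑ) t| ≤ w := by
    intro t
    by_cases ht : t ∈ S
    · rw [Set.indicator_of_mem ht]
      exact abs_tiltWD_le_of_mem_goodTD hβ hH hr hϑ hforest hm hm4 ht
    · rw [Set.indicator_of_notMem ht, abs_zero]; exact hw0
  -- on-`S` bound and linearisation
  have hFS : ∀ t ∈ S, |β * plaqCostAt (fundamentalRep (Fin 2)) x i j (cfgTD H β ϑ t)| ≤ β ^ (2 * ε) := by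
    intro t ht
    obtain ⟨h0, h1⟩ := beta_mul_plaqCostAt_mem_Icc_of_mem_goodTD hβ ht hx
    rw [abs_of_nonneg h0]; exact h1
  have hSur : ∀ t ∈ S, |β * plaqCostAt (fundamentalRep (Fin 2)) x i j (cfgTD H β ϑ t) - 1 / 2 * ∑ c, (F c + dirCirc H (x, i, j) (t c)) ^ 2| ≤ τ := by
    intro t ht
    have h := abs_beta_mul_plaqCostAt_sub_qObsD_le_of_mem_goodTD hβ hH hr hϑ hforest hm hm4 ht hx
    rw [qObsD_eq_half_sum_sq] at h
    exact h
  -- the core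
  have hcore := abs_kernelMean_sub_gaussian_le_core₂ (H := H) (β := β) W x i j hG hG0 hbad (M₀ := 4 * β) (M := β ^ (2 * ε))
    (Real.rpow_nonneg hβ.le _) hfM (cfgTD H β ϑ) (measurable_cfgTD β ϑ) hS hS0 hpS hp2 (measurable_tiltWD β ϑ) hWt hRep F (x, i, j) hFS hSur
  exact hcore

end Summit.QuantumFields.YangMills.Theorems.WeakCouplingRates

end
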